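import Mathlib
import Summits.KontsevichZagierPeriods.Zeta5Search.RecordCellAtlas
import HarnessLib

/-!
# ζ(5) search — the REMAINING structural cells of the record-ray first-digit atlas, typed (gen-2 g9 statement file)
HONEST FRAMING: systematic search; no irrationality claim unless certified.

Record dual ray `b(n) = bRec n = n·(41;17,16,15,14,13,12,11)`, direction `e₇`, `Cas₇ = casoratian (bRec n) 7`, `θ = p/n`.
gen-2 g9's STRUCTURAL FIRST-DIGIT ATLAS (`HOME/pub-zeta5-gen-2/g9/rayatlas.py` → `rayatlas_record.md`, REPORT-gen2-g9 §10.1) computes, for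
every face of the class arrangement (hence for ALL `n` at once), the multipole minimum `m`, the tree bound `casLB` (THEOREM LB) and the deep
orbit type-vectors; it predicts `v_p(Cas₇) ≥ casLB + 1` on ORIGIN cells (deep vectors on one line through 0) and AFFINE cells (affinely collinear,
moment range), and `≥ casLB + 2` on ZERO cells (every deep vector vanishes) — paper-proved for all `n` modulo the in-tree digit theorems
(REPORT §6.2, §9).  Census g11 typed the three heaviest cells (`CellAtlas.RecordCellA/B/D`, A and D now tree theorems, P1 g5/g6) and P1 g6 types
the origin cell `17n < 2p < 18n` (landed as `CellC.recordCellC`, p224766; referee R36 pointer fix).  This file types the EIGHT other structural cells with `θ > 4` as conjectures in the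
census format, so that census can price them and P1 can discharge them one by one (P1 g6's `digits_of_level` is generic in the level length).
Exact instances (gen-1 arithmetic, `g9/raycrit_record_n2-8.tsv` + `g9/record_cells_extra_instances.log`, every prime of the cell with n ≤ 8
plus the listed n ≤ 13 ones): 0 violations; `=` sharp, `+k` above the bound.

| cell | θ-range | integer form | kind | m | casLB | bound | exact instances (n,p): v |
|---|---|---|---|---|---|---|---|
| G | (4, 41/10] | 4n < p, 10p ≤ 41n | affine | −13 | −23 | −22 | (10,41) (13,53) = |
| H | (41/10, 17/4] | 41n < 10p, 4p ≤ 17n | zero | −14 | −25 | −23 | (7,29) +1, (9,37) +2, (4,17) = (θ = 17/4: casLB itself is −23) |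
| I | (9/2, 5] | 9n < 2p, p ≤ 5n | origin | −12 | −21 | −20 | (8,37) (5,23) (9,41) =, (4,19) (6,29) (9,43) +1 |
| J | (5, 16/3] | 5n < p, 3p ≤ 16n | origin | −11 | −19 | −18 | (6,31) (8,41) (7,37) (9,47) = |
| K | (11/2, 6] | 11n < 2p, p ≤ 6n | origin | −10 | −17 | −16 | (4,23) (8,47) (3,17) (5,29) (7,41) (9,53) = |
| L | (6, 19/3] | 6n < p, 3p ≤ 19n | zero | −10 | −17 | −15 | (6,37) (5,31) (7,43) (10,61) +1, (3,19) = (θ = 19/3: casLB itself is −15) |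
| M | (8, 41/5] | 8n < p, 5p ≤ 41n | affine | −7 | −11 | −10 | (5,41) (9,73) (11,89) = |
| N | (41/5, 17/2] | 41n < 5p, 2p ≤ 17n | zero | −8 | −13 | −11 | (2,17) (8,67) (7,59) =, (10,83) +1 |

Census g14 (15:20Z): instance-wise, origin cells coincide with LB♯ (rung S, 78/78), zero cells are LB♯ + 1 (33/33) and affine cells are new
(11/11); so for the conjectural ladder H, L, N (zero) and G, M (affine) are new beyond rung S, while every cell is a target for the PROVED ladder.
Cells H and L show a systematic further +1 in the instances (second-digit slack, REPORT §10.7–10.8); only the first-digit bound is asserted here.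
-/

namespace Summit.KontsevichZagierPeriods.Zeta5Search.RecordAtlas

open Summit.KontsevichZagierPeriods.Zeta5Search.CasoratianValuation (casoratian)
open Summit.KontsevichZagierPeriods.Zeta5Search.ClusterValuation (bRec)

/-- **RECORD CELL G** (`4 < θ ≤ 4.1`, affine, m = −13, casLB = −23): `v_p(Cas₇(b(n))) ≥ −22`.  OBSERVED/structurally certified (gen-2 g9). -/
@[conjecture] def RecordCellG : Prop :=
  ∀ n p : ℕ, 2 ≤ n → p.Prime → 4 * n < p → 10 * p ≤ 41 * n → casoratian (bRec n) 7 ≠ 0 →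
    (-22 : ℤ) ≤ padicValRat p (casoratian (bRec n) 7)

/-- **RECORD CELL H** (`4.1 < θ ≤ 4.25`, zero, m = −14, casLB = −25; at `θ = 17/4` casLB = −23): `v_p(Cas₇(b(n))) ≥ −23`. -/
@[conjecture] def RecordCellH : Prop :=
  ∀ n p : ℕ, 2 ≤ n → p.Prime → 41 * n < 10 * p → 4 * p ≤ 17 * n → casoratian (bRec n) 7 ≠ 0 →
    (-23 : ℤ) ≤ padicValRat p (casoratian (bRec n) 7)

/-- **RECORD CELL I** (`4.5 < θ ≤ 5`, origin, m = −12, casLB = −21): `v_p(Cas₇(b(n))) ≥ −20`. -/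
@[conjecture] def RecordCellI : Prop :=
  ∀ n p : ℕ, 2 ≤ n → p.Prime → 9 * n < 2 * p → p ≤ 5 * n → casoratian (bRec n) 7 ≠ 0 →
    (-20 : ℤ) ≤ padicValRat p (casoratian (bRec n) 7)

/-- **RECORD CELL J** (`5 < θ ≤ 16/3`, origin, m = −11, casLB = −19): `v_p(Cas₇(b(n))) ≥ −18`. -/
@[conjecture] def RecordCellJ : Prop :=
  ∀ n p : ℕ, 2 ≤ n → p.Prime → 5 * n < p → 3 * p ≤ 16 * n → casoratian (bRec n) 7 ≠ 0 →
    (-18 : ℤ) ≤ padicValRat p (casoratian (bRec n) 7)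

/-- **RECORD CELL K** (`5.5 < θ ≤ 6`, origin, m = −10, casLB = −17): `v_p(Cas₇(b(n))) ≥ −16`. -/
@[conjecture] def RecordCellK : Prop :=
  ∀ n p : ℕ, 2 ≤ n → p.Prime → 11 * n < 2 * p → p ≤ 6 * n → casoratian (bRec n) 7 ≠ 0 →
    (-16 : ℤ) ≤ padicValRat p (casoratian (bRec n) 7)

/-- **RECORD CELL L** (`6 < θ ≤ 19/3`, zero, m = −10, casLB = −17; at `θ = 19/3` casLB = −15): `v_p(Cas₇(b(n))) ≥ −15`
(instances show −14 except at θ = 19/3; only −15 is asserted). -/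
@[conjecture] def RecordCellL : Prop :=
  ∀ n p : ℕ, 2 ≤ n → p.Prime → 6 * n < p → 3 * p ≤ 19 * n → casoratian (bRec n) 7 ≠ 0 →
    (-15 : ℤ) ≤ padicValRat p (casoratian (bRec n) 7)

/-- **RECORD CELL M** (`8 < θ ≤ 8.2`, affine, m = −7, casLB = −11): `v_p(Cas₇(b(n))) ≥ −10`. -/
@[conjecture] def RecordCellM : Prop :=
  ∀ n p : ℕ, 2 ≤ n → p.Prime → 8 * n < p → 5 * p ≤ 41 * n → casoratian (bRec n) 7 ≠ 0 →
    (-10 : ℤ) ≤ padicValRat p (casoratian (bRec n) 7)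

/-- **RECORD CELL N** (`8.2 < θ ≤ 8.5`, zero, m = −8, casLB = −13): `v_p(Cas₇(b(n))) ≥ −11`. -/
@[conjecture] def RecordCellN : Prop :=
  ∀ n p : ℕ, 2 ≤ n → p.Prime → 41 * n < 5 * p → 2 * p ≤ 17 * n → casoratian (bRec n) 7 ≠ 0 →
    (-11 : ℤ) ≤ padicValRat p (casoratian (bRec n) 7)

end Summit.KontsevichZagierPeriods.Zeta5Search.RecordAtlas
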